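import Mathlib.Analysis.SpecialFunctions.Exp
import Mathlib.Analysis.SpecialFunctions.Exponential
import Mathlib.Analysis.Complex.ExponentialBounds
import HarnessLib

/-!
# Census closure, anchors: constants, the two anchors of the barrier, the envelope
# (stub C of the line `level-census-comparison`, crux `EnergyCurrentTails`, stmt-AtomisticToContinuum-9235)

Measure-free helper file of the registered stub `stub_censusClosure` (line lead's seat c2;
registered main theorem `closure_anchor`, `∀`-form of the datum anchor):
* `closure_constants`: the choice of `L, R, Δ` in the order required by `census_supersolution`
  (`…LevelCensusClosureCore`) and by the thresholds of the stubs F1/F2/F3 (all independent of `N`);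
* `closure_h0` / `closure_top`: the Gaussian census of the datum `K₀(N+1)e^{−α₀E}` lies below the
  barrier `β(N+1)e^{−αE}/E²` on `[E₀, ∞)` (`E² e^{−α₀E/2}` is non-increasing past `4/α₀`,
  `e^{x} ≥ 1 + x + x²/2`), and the total-energy tail `K₀^{N+2}e^{−α₀E}` lies below the barrier above
  `Etop(N) = max(E₀, 48K₀^{N+2}/(α₀³β(N+1)))` (`e^{x} ≥ x³/6`);
* `closure_envelope`: the abstract majorant `nhi = min(N+1, Chebyshev, barrier + δ₀ / barrier)`
  fed to `census_supersolution`, with its five properties and the domination of the census.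
-/

noncomputable section

namespace Summit.AtomisticToContinuum.HydrodynamicLimit.Theorems.EnergyCurrentTailsLevelCensus

/-! ## The constants -/

/-- **The constants of the closure**, chosen in the order `L → R → Δ` (then `E₀ = RΔ`): `L ≥ 4`
with `(A + C₁)e^{−L} ≤ c/200`; `R ≥ max(8, 8L, 20C₁(L+4)/c)`; `Δ` above `Δth`, `m₂`, `1`, the pair
condition `10A(96e^{L}+24)Rm₂/c`, and large enough that `E₀ = RΔ` clears the thresholds of F1/F3
and the anchoring conditions `2L/α₀`, `4/α₀`, `8K₀/(α₀²m₂)`. -/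
theorem closure_constants {c C₁ A : ℝ} (m₂ α₀ K₀ Δth Eth₁ Eth₃ : ℝ) (hc : 0 < c) (hC₁ : 0 < C₁)
    (hA : 0 < A) :
    ∃ (L Δ : ℝ) (R : ℕ), 4 ≤ L ∧ (A + C₁) * Real.exp (-L) ≤ c / 200 ∧ 8 ≤ (R : ℝ) ∧ 8 * L ≤ R ∧
      20 * C₁ * (L + 4) / c ≤ R ∧ m₂ ≤ Δ ∧ 10 * A * (96 * Real.exp L + 24) * R * m₂ / c ≤ Δ ∧
      Δth ≤ Δ ∧ 1 ≤ Δ ∧ Eth₁ ≤ R * Δ - Δ ∧ Eth₃ ≤ R * Δ ∧ 2 * L / α₀ ≤ R * Δ ∧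
      4 / α₀ ≤ R * Δ ∧ 8 * K₀ / (α₀ ^ 2 * m₂) ≤ R * Δ := by
  set L : ℝ := 4 + 200 * (A + C₁) / c with hL
  have hL0 : (0 : ℝ) ≤ 200 * (A + C₁) / c := by positivity
  have hL4 : 4 ≤ L := by linarith
  have hLe : (A + C₁) * Real.exp (-L) ≤ c / 200 := by
    have h1 : L + 1 ≤ Real.exp L := Real.add_one_le_exp L
    have h2 : 200 * (A + C₁) / c ≤ Real.exp L := by linarith
    rw [div_le_iff₀ hc] at h2
    rw [Real.exp_neg, ← div_eq_mul_inv, div_le_div_iff₀ (Real.exp_pos L) (by norm_num)]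
    linarith
  set R : ℕ := ⌈max 8 (max (8 * L) (20 * C₁ * (L + 4) / c))⌉₊ with hR
  have hRge : max 8 (max (8 * L) (20 * C₁ * (L + 4) / c)) ≤ (R : ℝ) := Nat.le_ceil _
  have hR8 : 8 ≤ (R : ℝ) := (le_max_left _ _).trans hRge
  have hRL : 8 * L ≤ R := ((le_max_left _ _).trans (le_max_right _ _)).trans hRge
  have hRc : 20 * C₁ * (L + 4) / c ≤ R := ((le_max_right _ _).trans (le_max_right _ _)).trans hRge
  set Δ : ℝ := max (max (max Δth m₂) (max (10 * A * (96 * Real.exp L + 24) * R * m₂ / c) 1))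
    (max (max Eth₁ Eth₃) (max (2 * L / α₀) (max (4 / α₀) (8 * K₀ / (α₀ ^ 2 * m₂))))) with hΔ
  have hΔ1 : 1 ≤ Δ := ((le_max_right _ _).trans (le_max_right _ _)).trans (le_max_left _ _)
  have hΔ0 : 0 < Δ := by linarith
  have hΔR : Δ ≤ R * Δ - Δ := by nlinarith
  have hΔR' : Δ ≤ R * Δ := by nlinarith
  refine ⟨L, Δ, R, hL4, hLe, hR8, hRL, hRc, ?_, ?_, ?_, hΔ1, ?_, ?_, ?_, ?_, ?_⟩
  · exact ((le_max_right _ _).trans (le_max_left _ _)).trans (le_max_left _ _)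
  · exact ((le_max_left _ _).trans (le_max_right _ _)).trans (le_max_left _ _)
  · exact ((le_max_left _ _).trans (le_max_left _ _)).trans (le_max_left _ _)
  · exact (((le_max_left _ _).trans (le_max_left _ _)).trans (le_max_right _ _)).trans hΔR
  · exact (((le_max_right _ _).trans (le_max_left _ _)).trans (le_max_right _ _)).trans hΔR'
  · exact (((le_max_left _ _).trans (le_max_right _ _)).trans (le_max_right _ _)).trans hΔR'
  · exact ((((le_max_left _ _).trans (le_max_right _ _)).trans (le_max_right _ _)).trans
      (le_max_right _ _)).trans hΔR'
  · exact ((((le_max_right _ _).trans (le_max_right _ _)).trans (le_max_right _ _)).trans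
      (le_max_right _ _)).trans hΔR'

/-! ## The two anchors of the barrier -/

/-- `E² e^{−aE}` is non-increasing past `2/a`: for `2/a ≤ E₀ ≤ E`,
`E² e^{−aE} ≤ E₀² e^{−aE₀}`. -/
theorem sq_mul_exp_neg_le {a E₀ E : ℝ} (ha : 0 < a) (hE₀ : 2 / a ≤ E₀) (hE : E₀ ≤ E) :
    E ^ 2 * Real.exp (-(a * E)) ≤ E₀ ^ 2 * Real.exp (-(a * E₀)) := by
  have hE₀pos : 0 < E₀ := lt_of_lt_of_le (by positivity) hE₀
  set y : ℝ := E - E₀ with hy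
  have hy0 : 0 ≤ y := by rw [hy]; linarith
  -- `E/E₀ = 1 + y/E₀ ≤ e^{y/E₀}`, squared, and `2y/E₀ ≤ a y`
  have h1 : E ≤ E₀ * Real.exp (y / E₀) := by
    have h := Real.add_one_le_exp (y / E₀)
    have : E = E₀ * (y / E₀ + 1) := by rw [hy]; field_simp; ring
    rw [this]
    exact mul_le_mul_of_nonneg_left h hE₀pos.le
  have hEpos : 0 ≤ E := by linarith
  have h2 : E ^ 2 ≤ E₀ ^ 2 * Real.exp (2 * (y / E₀)) := by
    have := pow_le_pow_left₀ hEpos h1 2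
    rw [mul_pow, ← Real.exp_nat_mul] at this
    simpa using this
  have h3 : 2 * (y / E₀) ≤ a * y := by
    rw [div_le_iff₀ ha] at hE₀
    rw [mul_div_assoc', div_le_iff₀ hE₀pos]
    nlinarith
  calc E ^ 2 * Real.exp (-(a * E)) ≤ E₀ ^ 2 * Real.exp (2 * (y / E₀)) * Real.exp (-(a * E)) :=
        mul_le_mul_of_nonneg_right h2 (Real.exp_pos _).le
    _ ≤ E₀ ^ 2 * Real.exp (a * y) * Real.exp (-(a * E)) := by
        apply mul_le_mul_of_nonneg_right _ (Real.exp_pos _).le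
        exact mul_le_mul_of_nonneg_left (Real.exp_le_exp.2 h3) (by positivity)
    _ = E₀ ^ 2 * Real.exp (-(a * E₀)) := by
        rw [mul_assoc, ← Real.exp_add]; congr 2; rw [hy]; ring

/-- **The datum anchor (`h0`)**: with `E₀ ≥ max(4/α₀, 8K₀/(α₀²m₂), 2L/α₀)`, `α = L/E₀`, `L ≥ 0`,
`β = m₂ e^{L} E₀`, the Gaussian census of the datum `K₀ M e^{−α₀E}` lies below the barrier
`βM e^{−αE}/E²` for every `E ≥ E₀`. -/
theorem closure_h0 {M m₂ L E₀ α β α₀ K₀ : ℝ} (hM : 0 < M) (hm₂ : 0 < m₂) (hL : 0 ≤ L)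
    (hα₀ : 0 < α₀) (hK₀ : 0 < K₀) (hE4 : 4 / α₀ ≤ E₀) (hEK : 8 * K₀ / (α₀ ^ 2 * m₂) ≤ E₀)
    (hEL : 2 * L / α₀ ≤ E₀) (hα : α = L / E₀) (hβ : β = m₂ * Real.exp L * E₀) {E : ℝ}
    (hE : E₀ ≤ E) :
    K₀ * M * Real.exp (-α₀ * E) ≤ β * M * Real.exp (-(α * E)) / E ^ 2 := by
  have hE₀pos : 0 < E₀ := lt_of_lt_of_le (by positivity) hE4
  have hEpos : 0 < E := by linarith
  set a : ℝ := α₀ / 2 with ha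
  have ha0 : 0 < a := by positivity
  -- `α E ≤ a E`
  have hαa : α ≤ a := by
    rw [hα, ha, div_le_iff₀ hE₀pos]; rw [div_le_iff₀ hα₀] at hEL; linarith
  have hexp : Real.exp (-α₀ * E) ≤ Real.exp (-(a * E)) * Real.exp (-(α * E)) := by
    rw [← Real.exp_add, Real.exp_le_exp]
    have := mul_le_mul_of_nonneg_right hαa hEpos.le
    rw [ha] at this ⊢; linarith
  -- `K₀ E² e^{−aE} ≤ K₀ E₀² e^{−aE₀} ≤ β`
  have h2a : 2 / a = 4 / α₀ := by rw [ha]; field_simp; norm_num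
  have hmono := sq_mul_exp_neg_le ha0 (by rw [h2a]; exact hE4) hE
  have hquad : a ^ 2 * E₀ ^ 2 / 2 ≤ Real.exp (a * E₀) := by
    have h := Real.quadratic_le_exp_of_nonneg (show 0 ≤ a * E₀ by positivity)
    nlinarith [mul_pos ha0 hE₀pos]
  have hanch : K₀ * (E₀ ^ 2 * Real.exp (-(a * E₀))) ≤ β := by
    rw [Real.exp_neg, hβ]
    have hex : 0 < Real.exp (a * E₀) := Real.exp_pos _
    rw [show K₀ * (E₀ ^ 2 * (Real.exp (a * E₀))⁻¹) = K₀ * E₀ ^ 2 / Real.exp (a * E₀) by ring,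
      div_le_iff₀ hex]
    have h1 : K₀ * E₀ ^ 2 ≤ m₂ * E₀ * (a ^ 2 * E₀ ^ 2 / 2) := by
      -- `8K₀/(α₀² m₂) ≤ E₀` i.e. `K₀ ≤ m₂ a² E₀ / 2`
      rw [div_le_iff₀ (by positivity)] at hEK
      have : a ^ 2 = α₀ ^ 2 / 4 := by rw [ha]; ring
      rw [this]
      nlinarith [sq_nonneg E₀, hE₀pos]
    have h2 : m₂ * E₀ * (a ^ 2 * E₀ ^ 2 / 2) ≤ m₂ * Real.exp L * E₀ * Real.exp (a * E₀) := by
      have hL1 : 1 ≤ Real.exp L := Real.one_le_exp hL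
      calc m₂ * E₀ * (a ^ 2 * E₀ ^ 2 / 2) ≤ m₂ * E₀ * Real.exp (a * E₀) :=
            mul_le_mul_of_nonneg_left hquad (by positivity)
        _ = m₂ * 1 * E₀ * Real.exp (a * E₀) := by ring
        _ ≤ m₂ * Real.exp L * E₀ * Real.exp (a * E₀) := by gcongr
    linarith
  calc K₀ * M * Real.exp (-α₀ * E) ≤ K₀ * M * (Real.exp (-(a * E)) * Real.exp (-(α * E))) :=
        mul_le_mul_of_nonneg_left hexp (by positivity)
    _ = M * Real.exp (-(α * E)) * (K₀ * (E ^ 2 * Real.exp (-(a * E)))) / E ^ 2 := by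
        field_simp
    _ ≤ M * Real.exp (-(α * E)) * β / E ^ 2 := by
        apply div_le_div_of_nonneg_right _ (by positivity)
        apply mul_le_mul_of_nonneg_left _ (by positivity)
        exact (mul_le_mul_of_nonneg_left hmono hK₀.le).trans hanch
    _ = β * M * Real.exp (-(α * E)) / E ^ 2 := by ring

/-- **The top anchor**: with `α ≤ α₀/2` (and `α ≥ 0`), above
`Etop = max(E₀, 48 K^{·}/(α₀³ βM))` the total-energy tail `Ktot e^{−α₀E}` lies below the barrier. -/
theorem closure_top {M β α α₀ Ktot E₀ : ℝ} (hM : 0 < M) (hβ : 0 < β) (hα₀ : 0 < α₀) (hK : 0 < Ktot)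
    (hE₀ : 0 < E₀) (hαa : α ≤ α₀ / 2) {E : ℝ}
    (hE : max E₀ (48 * Ktot / (α₀ ^ 3 * β * M)) ≤ E) :
    Ktot * Real.exp (-α₀ * E) ≤ β * M * Real.exp (-(α * E)) / E ^ 2 := by
  have hEpos : 0 < E := lt_of_lt_of_le hE₀ ((le_max_left _ _).trans hE)
  have hEt : 48 * Ktot / (α₀ ^ 3 * β * M) ≤ E := (le_max_right _ _).trans hE
  set a : ℝ := α₀ / 2 with ha
  have ha0 : 0 < a := by positivity
  have hexp : Real.exp (-α₀ * E) ≤ Real.exp (-(a * E)) * Real.exp (-(α * E)) := by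
    rw [← Real.exp_add, Real.exp_le_exp]
    have := mul_le_mul_of_nonneg_right hαa hEpos.le
    rw [ha] at this ⊢; linarith
  -- `e^{aE} ≥ (aE)³/6`, so `Ktot E² e^{−aE} ≤ 6 Ktot/(a³ E) ≤ βM`
  have hcube : (a * E) ^ 3 / 6 ≤ Real.exp (a * E) := by
    have h := Real.pow_div_factorial_le_exp (a * E) (by positivity) 3
    norm_num [Nat.factorial] at h
    exact h
  have hmain : Ktot * (E ^ 2 * Real.exp (-(a * E))) ≤ β * M := by
    rw [Real.exp_neg]
    have hex : 0 < Real.exp (a * E) := Real.exp_pos _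
    rw [show Ktot * (E ^ 2 * (Real.exp (a * E))⁻¹) = Ktot * E ^ 2 / Real.exp (a * E) by ring,
      div_le_iff₀ hex]
    have h1 : Ktot * E ^ 2 * 6 ≤ β * M * ((a * E) ^ 3) := by
      rw [div_le_iff₀ (by positivity)] at hEt
      have : a ^ 3 = α₀ ^ 3 / 8 := by rw [ha]; ring
      rw [mul_pow, this]
      nlinarith [sq_nonneg E, hEpos]
    nlinarith [mul_pos hβ hM]
  calc Ktot * Real.exp (-α₀ * E) ≤ Ktot * (Real.exp (-(a * E)) * Real.exp (-(α * E))) :=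
        mul_le_mul_of_nonneg_left hexp hK.le
    _ = Real.exp (-(α * E)) * (Ktot * (E ^ 2 * Real.exp (-(a * E)))) / E ^ 2 := by
        field_simp
    _ ≤ Real.exp (-(α * E)) * (β * M) / E ^ 2 := by
        apply div_le_div_of_nonneg_right _ (by positivity)
        exact mul_le_mul_of_nonneg_left hmain (Real.exp_pos _).le
    _ = β * M * Real.exp (-(α * E)) / E ^ 2 := by ring

/-! ## The envelope fed to `census_supersolution` -/

/-- **The abstract census majorant.**  If on a set of times `W` the census `n r ·` is `≤ M`,
Chebyshev `≤ M m₂/E'` for `E' > 0`, `≤ b + δ₀` on `[E₀, Etop]` and `≤ b` above `Etop`, then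
`nhi := min(M, Chebyshev, barrier-or-M)` is a nonnegative function with the same four bounds that
dominates `n r ·` for every `r ∈ W`. -/
theorem closure_envelope {M m₂ E₀ Etop δ₀ : ℝ} {b : ℝ → ℝ} {n : ℝ → ℝ → ℝ} {W : Set ℝ}
    (hM : 0 ≤ M) (hm₂ : 0 ≤ m₂) (hbδ : ∀ E', E₀ ≤ E' → E' ≤ Etop → 0 ≤ b E' + δ₀)
    (hbpos : ∀ E', Etop < E' → 0 ≤ b E') (h1 : ∀ r ∈ W, ∀ E', n r E' ≤ M)
    (h2 : ∀ r ∈ W, ∀ E', 0 < E' → n r E' ≤ M * m₂ / E')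
    (h4a : ∀ r ∈ W, ∀ E', E₀ ≤ E' → E' ≤ Etop → n r E' ≤ b E' + δ₀)
    (h4b : ∀ r ∈ W, ∀ E', Etop < E' → n r E' ≤ b E') :
    ∃ nhi : ℝ → ℝ, (∀ E', 0 ≤ nhi E') ∧ (∀ E', nhi E' ≤ M) ∧
      (∀ E', 0 < E' → nhi E' ≤ M * m₂ / E') ∧
      (∀ E', E₀ ≤ E' → E' ≤ Etop → nhi E' ≤ b E' + δ₀) ∧ (∀ E', Etop < E' → nhi E' ≤ b E') ∧
      (∀ r ∈ W, ∀ E', n r E' ≤ nhi E') := by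
  classical
  refine ⟨fun E' => min M (min (if 0 < E' then M * m₂ / E' else M)
    (if E' ≤ Etop then (if E₀ ≤ E' then b E' + δ₀ else M) else b E')), ?_, ?_, ?_, ?_, ?_, ?_⟩
  · intro E'
    refine le_min hM (le_min ?_ ?_)
    · split_ifs with h
      · positivity
      · exact hM
    · split_ifs with h h'
      · exact hbδ E' h' h
      · exact hM
      · exact hbpos E' (not_le.1 h)
  · intro E'; exact min_le_left _ _
  · intro E' hE'
    refine (min_le_right _ _).trans ((min_le_left _ _).trans ?_)
    rw [if_pos hE']
  · intro E' h₀ ht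
    refine (min_le_right _ _).trans ((min_le_right _ _).trans ?_)
    rw [if_pos ht, if_pos h₀]
  · intro E' ht
    refine (min_le_right _ _).trans ((min_le_right _ _).trans ?_)
    rw [if_neg (not_le.2 ht)]
  · intro r hr E'
    refine le_min (h1 r hr E') (le_min ?_ ?_)
    · split_ifs with h
      · exact h2 r hr E' h
      · exact h1 r hr E'
    · split_ifs with h h'
      · exact h4a r hr E' h' h
      · exact h1 r hr E'
      · exact h4b r hr E' (not_le.1 h)

/-- **Registered main theorem of this file (`∀`-form of the datum anchor `closure_h0`).** -/
theorem closure_anchor :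
    ∀ (M m₂ L E₀ α β α₀ K₀ : ℝ), 0 < M → 0 < m₂ → 0 ≤ L → 0 < α₀ → 0 < K₀ → 4 / α₀ ≤ E₀ →
      8 * K₀ / (α₀ ^ 2 * m₂) ≤ E₀ → 2 * L / α₀ ≤ E₀ → α = L / E₀ → β = m₂ * Real.exp L * E₀ →
      ∀ E : ℝ, E₀ ≤ E → K₀ * M * Real.exp (-α₀ * E) ≤ β * M * Real.exp (-(α * E)) / E ^ 2 :=
  fun _ _ _ _ _ _ _ _ hM hm₂ hL hα₀ hK₀ hE4 hEK hEL hα hβ _ hE =>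
    closure_h0 hM hm₂ hL hα₀ hK₀ hE4 hEK hEL hα hβ hE

end Summit.AtomisticToContinuum.HydrodynamicLimit.Theorems.EnergyCurrentTailsLevelCensus

end
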